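/-
Copyright: statement-level skeleton of a published paper (lit-balaban cell, Phase-2 proof seat p25, gen 17). No proof
claims beyond what the kernel checks below.
-/
import Literature.MathematicalPhysics.QuantumFieldTheory.BalabanImbrieJaffe1984to88.BIJ88LabelledCoefBound312
import Literature.MathematicalPhysics.QuantumFieldTheory.BalabanImbrieJaffe1984to88.BIJ88Resummation312

/-!
# `BalabanImbrieJaffe1984to88.BIJ88LabelledTermCount312` — T. Bałaban, J. Imbrie, A. Jaffe, *Effective action and cluster
properties of the abelian Higgs model*, Commun. Math. Phys. **114** (1988) 257–315 [BalabanImbrieJaffe1988], §5.14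
p. 311–312 [PDF 55–56]: p. 311 *"After sufficiently many integrations by parts, all components of X will be
complete."*; p. 312 *"Summing all possible diagrams in X_c gives the observable for the next step there,
F^L_{k+1,loc}(X_c). Summing all terms in X_r gives an observable F_{k,rem}(X_r)."* —
**HOW MANY TERMS.**  The sibling `BIJ88LabelledCoefBound312` (p25 gen 17) bounds every TERM of the labelled
expansion; this file COUNTS the terms — the run of one component has at most `W^{rpot}` outcomes, weighted by the
potential they leave (`run_wcount_le`), and the expansion of `done, rest` at most `W^{Φ(done,rest)}` terms
(`card_expand_le`), for any `W ≥ Φ + Σ_m |legs m|` — and records the sizes (legs and `χ′`-directions of a term are paid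
by the same potential, `expand_size_le`; they stay in `Dir`, `expand_dir`), so that print's two sums *"F^L_{k+1,loc}(X_c)"*
(`cst`, `fl`) and *"F_{k,rem}(X_r)"* (`remv`) can be bounded in the sibling `BIJ88LabelledSumBounds312` with satisfiable
large-factor hypotheses.  Also the label facts print uses on p. 312 (*"each one covers at least one X_{σ_i}"*, there for
the `X_{r′}`): every block and every remainder component of a term carries at least one observable
(`expand_lab_nonempty`), and a term of `remv(O)`, `O ≠ ∅`, has a remainder component (`groups_ne_zero_of_consts_eq_zero`).

statement-level skeleton of published theorems with citation tags; proofs where landed; nothing here is a claim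
about the Yang–Mills mass gap

PDF held: `paper:balaban1988-cmp114-bij-abelian-higgs-effective-action` (journal page = PDF page + 256); p. 311–312 =
PDF 55–56 (`p0055.txt` L34, `p0056.txt` L3–5 / L18–19 re-read this session; the quoted sentences are verbatim there up
to the OCR of sub/superscripts).

CITATION HEADER (lean-in-tree rule).  lit-balaban cell (HOME `run/shared/lean/pub/lit-balaban/`), Phase 2, seat p25
gen 17; row **C2.Claim@312** of `HOME/lit-balaban-r16/ROWS-C2-part2.md` (owner r16, referee ref-5; head
`BIJ88Sect5StatementsPart4.Ineq312` NOT touched — a MEMBER next to `BIJ88LabelledCoefBound312`).  USED BY NAME, nothing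
restated: `BIJ88LabelledRun311` (`run`, `rpot`, `rpot_*`, `pristine`, `LGrp.absorb`, `Outcome`, `sum_map_bind/_fbind/
_mbind`, `mbind`), `BIJ88LabelledRunEnv311` (`run_ind'`, `run_rest_subset`, `run_done_le`, `run_mono`),
`BIJ88LabelledExpansion311` (`expand`, `RTerm`, `oact`, `gintM`, `tval`), `BIJ88Resummation312` (`cst`, `fl`, `remv`,
`expand_lab`), `BIJ88LabelledCoefBound312.run_dir`.

## What is proved (0 `sorry`, standard axioms, no definitions, no `Prop` facts)

* §1 `run_rpot_dirs_le` (the potential left plus the `χ′`-directions produced is at most the potential at the start),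
  `run_dirs_mem` (directions are `A⁻¹u`, `u ∈ Dir`), **`run_wcount_le`** (`Σ_{o ∈ run g rest done} W^{rpot o} ≤
  W^{rpot g rest done}` once `W ≥ rpot + Σ_m|legs m|`).
* §2 `rpot_pristine_le_pot`, `expand_pot_key` (the telescoping inequality of the sibling, public), **`card_expand_le`**,
  **`card_expand_init_le`** (`#expand 0 K ≤ (Φ₀(K) + Σ_m|legs m|)^{Φ₀(K)}`), `expand_size_le`, `expand_dir`.
* §3 `expand_lab_nonempty`, `groups_ne_zero_of_consts_eq_zero`.
HONEST SCOPE: as in the siblings — contraction-graph components, one covariance of unrestricted range, no geometry; the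
counts are the crude ones (every leg may contract to every other: `W` grows with the number of observables, so `W^{Φ₀}`
is factorial-like in `|K|` — print's locality, which keeps the number of terms per component bounded, is not available
here).  CURRENCY: feeds none of `BIJ88Sect5StatementsPart4.Ineq312` / `hobs` / `RemainderComponent` by name.  NOT summit
progress; NOT continuum; NOT Clay.  Imports `BIJ88LabelledCoefBound312`, `BIJ88Resummation312`; modifies nothing.
-/

noncomputable section

namespace Literature.MathematicalPhysics.QuantumFieldTheory.BalabanImbrieJaffe1984to88.BIJ88LabelledTermCount312

open Classical MeasureTheory Matrix Finset
open scoped BigOperators ContDiff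
open Literature.MathematicalPhysics.QuantumFieldTheory.Balaban1983to89
open B2Eq228Conditioning (weight source)
open BIJ88VertexIbp311 (lmono vexp)
open BIJ88WickDerivatives305 (dlist)
open BIJ88VertexComponents311 (Grp maxArity)
open BIJ88LabelledRun311 BIJ88LabelledRunEnv311 BIJ88LabelledExpansion311 BIJ88LabelledRemainderCount312
open BIJ88Resummation312 (cst fl remv expand_lab)
open BIJ88LabelledCoefBound312

variable {S : Type} [Fintype S] [DecidableEq S] {ι : Type} [Fintype ι] {κ : Type}

/-! ## §1  Counting the outcomes of a run -/

section Run

variable [DecidableEq κ]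
variable {A : Matrix S S ℝ} {f : S → ℝ} {c : ι → ℝ} {legs : ι → List (S → ℝ)} {obs : κ → List (S → ℝ)} {M : ℕ}
  {Dir : Set (S → ℝ)}

/-- **Every event lowers the potential, and a contraction to `χ′` is itself paid by it**: for every outcome `o` of
`run g rest done`, `rpot o + |D_o| ≤ rpot g rest done`. [cite: BalabanImbrieJaffe1988, §5.14 p.311] -/
theorem run_rpot_dirs_le (g : LGrp S κ) (rest : Finset κ) (done : Multiset (LGrp S κ)) :
    ∀ o ∈ run A f c legs obs M g rest done,
      rpot obs M (maxArity legs) o.g o.rest o.done + o.D.length ≤ rpot obs M (maxArity legs) g rest done := by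
  refine run_ind' (P := fun g rest done o =>
      rpot obs M (maxArity legs) o.g o.rest o.done + o.D.length ≤ rpot obs M (maxArity legs) g rest done)
    (fun _ _ _ _ => by simp) ?_ ?_ ?_ ?_ ?_ ?_ g rest done
  · intro g rest done u L _ hp i o _ h
    rw [Outcome.scale_g, Outcome.scale_rest, Outcome.scale_done, Outcome.scale_D]
    exact h.trans (rpot_pair obs M _ rest done hp i).le
  · intro g rest done u L _ hp j hj i o _ h
    rw [Outcome.scale_g, Outcome.scale_rest, Outcome.scale_done, Outcome.scale_D]
    exact h.trans (rpot_pristine obs M _ rest done hp hj i _).le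
  · intro g rest done u L _ hp h hh i _ o _ h'
    rw [Outcome.scale_g, Outcome.scale_rest, Outcome.scale_done, Outcome.scale_D]
    exact h'.trans (rpot_absorb obs M _ rest done hp hh i).le
  · intro g rest done u L _ hp o _ h
    rw [Outcome.scale_g, Outcome.scale_rest, Outcome.scale_done, Outcome.scale_D]
    exact h.trans (rpot_drop obs M _ rest done hp _).le
  · intro g rest done u L _ hp o _ h
    rw [Outcome.push_g, Outcome.push_rest, Outcome.push_done, Outcome.push_D, List.length_cons, ← add_assoc]
    exact Nat.succ_le_of_lt (lt_of_le_of_lt h (rpot_drop obs M _ rest done hp _))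
  · intro g rest done u L hc hp m j o _ h
    rw [Outcome.bump_g, Outcome.bump_rest, Outcome.bump_done, Outcome.bump_D, Outcome.scale_g, Outcome.scale_rest,
      Outcome.scale_done, Outcome.scale_D]
    exact h.trans (rpot_vertex obs M rest done legs hp (Grp.nv_lt_of_not_complete hc) m j).le

/-- **The `χ′`-directions of an outcome are `A⁻¹u` for head legs `u ∈ Dir`** (given that `Dir` holds all legs in play).
[cite: BalabanImbrieJaffe1988, §5.14 p.311] -/
theorem run_dirs_mem (hobs : ∀ j, ∀ w ∈ obs j, w ∈ Dir) (hlegs : ∀ m, ∀ w ∈ legs m, w ∈ Dir)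
    (g : LGrp S κ) (rest : Finset κ) (done : Multiset (LGrp S κ)) :
    ∀ o ∈ run A f c legs obs M g rest done, (∀ w ∈ g.pend, w ∈ Dir) → (∀ h ∈ done, ∀ w ∈ h.pend, w ∈ Dir) →
      ∀ z ∈ o.D, ∃ u ∈ Dir, A⁻¹ *ᵥ u = z := by
  refine run_ind' (P := fun g _ done o => (∀ w ∈ g.pend, w ∈ Dir) → (∀ h ∈ done, ∀ w ∈ h.pend, w ∈ Dir) →
      ∀ z ∈ o.D, ∃ u ∈ Dir, A⁻¹ *ᵥ u = z)
    (fun _ _ _ _ _ _ z hz => absurd hz List.not_mem_nil) ?_ ?_ ?_ ?_ ?_ ?_ g rest done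
  · intro g rest done u L _ hp i o _ h hg hd
    rw [Outcome.scale_D]
    exact h (fun w hw => hg w (by rw [hp]; exact List.mem_cons_of_mem u (List.mem_of_mem_eraseIdx hw))) hd
  · intro g rest done u L _ hp j _ i o _ h hg hd
    rw [Outcome.scale_D]
    refine h (fun w hw => ?_) hd
    rcases List.mem_append.1 hw with hw | hw
    · exact hg w (by rw [hp]; exact List.mem_cons_of_mem u hw)
    · exact hobs j w (List.mem_of_mem_eraseIdx hw)
  · intro g rest done u L _ hp h hh i _ o _ h' hg hd
    rw [Outcome.scale_D]
    refine h' (fun w hw => ?_) (fun h' hh' => hd h' (Multiset.mem_of_mem_erase hh'))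
    simp only [LGrp.absorb] at hw
    rcases List.mem_append.1 hw with hw | hw
    · exact hg w (by rw [hp]; exact List.mem_cons_of_mem u hw)
    · exact hd h hh w (List.mem_of_mem_eraseIdx hw)
  · intro g rest done u L _ hp o _ h hg hd
    rw [Outcome.scale_D]
    exact h (fun w hw => hg w (by rw [hp]; exact List.mem_cons_of_mem u hw)) hd
  · intro g rest done u L _ hp o _ h hg hd z hz
    rw [Outcome.push_D, List.mem_cons] at hz
    rcases hz with rfl | hz
    · exact ⟨u, hg u (by rw [hp]; exact List.mem_cons_self), rfl⟩
    · exact h (fun w hw => hg w (by rw [hp]; exact List.mem_cons_of_mem u hw)) hd z hz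
  · intro g rest done u L _ hp m j o _ h hg hd
    rw [Outcome.bump_D, Outcome.scale_D]
    refine h (fun w hw => ?_) hd
    rcases List.mem_append.1 hw with hw | hw
    · exact hg w (by rw [hp]; exact List.mem_cons_of_mem u hw)
    · exact hlegs m w (List.mem_of_mem_eraseIdx hw)

/-- **THE NUMBER OF OUTCOMES OF A RUN, WEIGHTED BY THE POTENTIAL THEY LEAVE** (p. 311 *"After sufficiently many
integrations by parts, all components of X will be complete"*, counted): if `W ≥ rpot g rest done + Σ_m |legs m|` (a
bound on the number of ways one integration by parts can go, at every later state too), then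
`Σ_{o ∈ run g rest done} W^{rpot o} ≤ W^{rpot g rest done}`; in particular the run has at most `W^{rpot g rest done}`
outcomes. [cite: BalabanImbrieJaffe1988, §5.14 p.311] -/
theorem run_wcount_le : ∀ (n : ℕ) (g : LGrp S κ) (rest : Finset κ) (done : Multiset (LGrp S κ)),
    rpot obs M (maxArity legs) g rest done < n → ∀ W : ℕ,
      rpot obs M (maxArity legs) g rest done + ∑ m, (legs m).length ≤ W →
        ((run A f c legs obs M g rest done).map fun o => W ^ rpot obs M (maxArity legs) o.g o.rest o.done).sum
          ≤ W ^ rpot obs M (maxArity legs) g rest done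
  | 0, _, _, _, hn => fun _ _ => absurd hn (Nat.not_lt_zero _)
  | n + 1, g, rest, done, hn => by
    intro W hW
    have hn' : rpot obs M (maxArity legs) g rest done ≤ n := Nat.lt_succ_iff.1 hn
    have hR : 1 ≤ rpot obs M (maxArity legs) g rest done := by simp only [rpot]; omega
    have hW0 : 0 < W := by omega
    have IH : ∀ g' rest' done', rpot obs M (maxArity legs) g' rest' done' < rpot obs M (maxArity legs) g rest done →
        ((run A f c legs obs M g' rest' done').map fun o => W ^ rpot obs M (maxArity legs) o.g o.rest o.done).sum
          ≤ W ^ (rpot obs M (maxArity legs) g rest done - 1) := fun g' rest' done' hlt =>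
      (run_wcount_le n g' rest' done' (lt_of_lt_of_le hlt hn') W (by omega)).trans
        (Nat.pow_le_pow_right hW0 (by omega))
    by_cases hc : g.complete M = true
    · rw [run_of_complete A f c legs obs M hc]
      simp only [Multiset.map_singleton, Multiset.sum_singleton, le_refl]
    · obtain ⟨u, L, hp⟩ := List.exists_cons_of_ne_nil (Grp.pend_ne_nil_of_not_complete hc)
      have hnv : g.nv < M := Grp.nv_lt_of_not_complete hc
      rw [run_of_not_complete A f c legs obs M hc hp rest done]
      simp only [Multiset.map_add, Multiset.sum_add, sum_map_bind, sum_map_fbind, sum_map_mbind, Multiset.map_map,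
        Function.comp_def, Outcome.scale_g, Outcome.scale_rest, Outcome.scale_done, Outcome.push_g, Outcome.push_rest,
        Outcome.push_done, Outcome.bump_g, Outcome.bump_rest, Outcome.bump_done]
      -- the six blocks, each outcome family bounded by the induction hypothesis
      have h1 : ∑ i ∈ range L.length, ((run A f c legs obs M ⟨⟨L.eraseIdx i, g.nchi, g.nv⟩, g.lab⟩ rest done).map
            fun o => W ^ rpot obs M (maxArity legs) o.g o.rest o.done).sum
          ≤ L.length * W ^ (rpot obs M (maxArity legs) g rest done - 1) :=
        (Finset.sum_le_sum fun i _ => IH _ _ _ (rpot_pair obs M _ rest done hp i)).trans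
          (by rw [Finset.sum_const, Finset.card_range, smul_eq_mul])
      have h2 : ∑ j ∈ rest.attach, ∑ i ∈ range (obs j).length,
            ((run A f c legs obs M ⟨⟨L ++ (obs j).eraseIdx i, g.nchi, g.nv⟩, g.lab ∪ {j.1}⟩ (rest.erase j) done).map
              fun o => W ^ rpot obs M (maxArity legs) o.g o.rest o.done).sum
          ≤ (∑ j ∈ rest, (obs j).length) * W ^ (rpot obs M (maxArity legs) g rest done - 1) := by
        calc _ ≤ ∑ j ∈ rest.attach, (obs j).length * W ^ (rpot obs M (maxArity legs) g rest done - 1) :=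
              Finset.sum_le_sum fun j _ => (Finset.sum_le_sum fun i _ =>
                IH _ _ _ (rpot_pristine obs M _ rest done hp j.2 i _)).trans
                  (by rw [Finset.sum_const, Finset.card_range, smul_eq_mul])
          _ = (∑ j ∈ rest, (obs j).length) * W ^ (rpot obs M (maxArity legs) g rest done - 1) := by
              rw [Finset.sum_attach rest (fun j => (obs j).length * W ^ (rpot obs M (maxArity legs) g rest done - 1)),
                Finset.sum_mul]
      have h3 : (done.attach.map fun h => ∑ i ∈ range h.1.pend.length,
            ((run A f c legs obs M (LGrp.absorb L g h.1 i) rest (done.erase h.1)).map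
              fun o => W ^ rpot obs M (maxArity legs) o.g o.rest o.done).sum).sum
          ≤ (done.map fun h => h.pend.length).sum * W ^ (rpot obs M (maxArity legs) g rest done - 1) := by
        calc _ ≤ (done.attach.map fun h => h.1.pend.length * W ^ (rpot obs M (maxArity legs) g rest done - 1)).sum :=
              Multiset.sum_map_le_sum_map _ _ fun h _ => (Finset.sum_le_sum fun i _ =>
                IH _ _ _ (rpot_absorb obs M _ rest done hp h.2 i)).trans
                  (by rw [Finset.sum_const, Finset.card_range, smul_eq_mul])
          _ = (done.map fun h => h.pend.length * W ^ (rpot obs M (maxArity legs) g rest done - 1)).sum := by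
              rw [← Multiset.attach_map_val' done]
          _ = (done.map fun h => h.pend.length).sum * W ^ (rpot obs M (maxArity legs) g rest done - 1) := by
              rw [Multiset.sum_map_mul_right]
      have h4 : ((run A f c legs obs M ⟨⟨L, g.nchi, g.nv⟩, g.lab⟩ rest done).map
            fun o => W ^ rpot obs M (maxArity legs) o.g o.rest o.done).sum
          ≤ W ^ (rpot obs M (maxArity legs) g rest done - 1) := IH _ _ _ (rpot_drop obs M _ rest done hp _)
      have h5 : ((run A f c legs obs M ⟨⟨L, g.nchi + 1, g.nv⟩, g.lab⟩ rest done).map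
            fun o => W ^ rpot obs M (maxArity legs) o.g o.rest o.done).sum
          ≤ W ^ (rpot obs M (maxArity legs) g rest done - 1) := IH _ _ _ (rpot_drop obs M _ rest done hp _)
      have h6 : ∑ m, ∑ j ∈ range (legs m).length,
            ((run A f c legs obs M ⟨⟨L ++ (legs m).eraseIdx j, g.nchi, g.nv + 1⟩, g.lab⟩ rest done).map
              fun o => W ^ rpot obs M (maxArity legs) o.g o.rest o.done).sum
          ≤ (∑ m, (legs m).length) * W ^ (rpot obs M (maxArity legs) g rest done - 1) := by
        calc _ ≤ ∑ m, (legs m).length * W ^ (rpot obs M (maxArity legs) g rest done - 1) :=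
              Finset.sum_le_sum fun m _ => (Finset.sum_le_sum fun j _ =>
                IH _ _ _ (rpot_vertex obs M rest done legs hp hnv m j)).trans
                  (by rw [Finset.sum_const, Finset.card_range, smul_eq_mul])
          _ = (∑ m, (legs m).length) * W ^ (rpot obs M (maxArity legs) g rest done - 1) := by rw [Finset.sum_mul]
      -- the number of branches is at most `W`
      have e : rpot obs M (maxArity legs) g rest done = L.length + 1 + 1 + (M - g.nv) * maxArity legs
          + ∑ j ∈ rest, (obs j).length + (done.map fun h => h.pend.length).sum := by
        simp only [rpot, hp, List.length_cons]
      have hbr : L.length + (∑ j ∈ rest, (obs j).length) + (done.map fun h => h.pend.length).sum + 1 + 1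
          + ∑ m, (legs m).length ≤ W := by omega
      refine (add_le_add (add_le_add (add_le_add (add_le_add (add_le_add h1 h2) h3) h4) h5) h6).trans ?_
      calc _ = (L.length + (∑ j ∈ rest, (obs j).length) + (done.map fun h => h.pend.length).sum + 1 + 1
            + ∑ m, (legs m).length) * W ^ (rpot obs M (maxArity legs) g rest done - 1) := by ring
        _ ≤ W * W ^ (rpot obs M (maxArity legs) g rest done - 1) := Nat.mul_le_mul_right _ hbr
        _ = W ^ rpot obs M (maxArity legs) g rest done := by
            rw [← pow_succ', Nat.sub_add_cancel hR]

end Run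

/-! ## §2  Counting the terms of the expansion; sizes and directions of a term -/

section Expand

variable [LinearOrder κ]
variable {A : Matrix S S ℝ} {f : S → ℝ} {c : ι → ℝ} {legs : ι → List (S → ℝ)} {obs : κ → List (S → ℝ)} {M : ℕ}
  {Dir : Set (S → ℝ)} {B cM : ℝ}

omit [Fintype S] [DecidableEq S] [Fintype ι] [LinearOrder κ] in
/-- Splitting the observable part of the potential (bookkeeping). [cite: BalabanImbrieJaffe1988, §5.14 p.311] -/
theorem sum_obs_split (obs : κ → List (S → ℝ)) (M Am : ℕ) (s : Finset κ) :
    ∑ j ∈ s, ((obs j).length + 1 + M * Am) = ∑ j ∈ s, (obs j).length + ∑ _j ∈ s, (1 + M * Am) := by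
  rw [← Finset.sum_add_distrib]
  exact Finset.sum_congr rfl fun _ _ => add_assoc _ _ _

omit [Fintype S] [DecidableEq S] in
/-- **The run of the least observable starts below the potential of the state.** [cite: BalabanImbrieJaffe1988, §5.14 p.311] -/
theorem rpot_pristine_le_pot {rest : Finset κ} (h : rest.Nonempty) (done : Multiset (LGrp S κ)) :
    rpot obs M (maxArity legs) (pristine obs (rest.min' h)) (rest.erase (rest.min' h)) done
      ≤ (done.map fun h => h.pend.length).sum + ∑ j ∈ rest, ((obs j).length + 1 + M * maxArity legs) := by
  have e : rpot obs M (maxArity legs) (pristine obs (rest.min' h)) (rest.erase (rest.min' h)) done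
      = (obs (rest.min' h)).length + 1 + M * maxArity legs + ∑ j ∈ rest.erase (rest.min' h), (obs j).length
        + (done.map fun h => h.pend.length).sum := by
    simp only [rpot, pristine, Nat.sub_zero]
  rw [e, ← Finset.add_sum_erase rest (fun j => (obs j).length + 1 + M * maxArity legs) (rest.min'_mem h),
    sum_obs_split obs M (maxArity legs) (rest.erase _)]
  omega

/-- **THE TELESCOPING INEQUALITY OF THE POTENTIAL** (the bookkeeping of `BIJ88LabelledCoefBound312.expand_coef_bound`,
recorded): for an outcome `o` of the run of the least observable `i` of `rest` and any `extra ≤ |pend(o.g)|`,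
`rpot(start) + (extra + Σ_{o.done}|pend| + Σ_{j∈o.rest}(|obs j|+1+M·A)) ≤ Φ(done,rest) + rpot(o)`.
[cite: BalabanImbrieJaffe1988, §5.14 p.311] -/
theorem expand_pot_key {rest : Finset κ} (h : rest.Nonempty) (done : Multiset (LGrp S κ)) :
    ∀ o ∈ run A f c legs obs M (pristine obs (rest.min' h)) (rest.erase (rest.min' h)) done,
      ∀ extra, extra ≤ o.g.pend.length →
        rpot obs M (maxArity legs) (pristine obs (rest.min' h)) (rest.erase (rest.min' h)) done
            + (extra + (o.done.map fun h => h.pend.length).sum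
              + ∑ j ∈ o.rest, ((obs j).length + 1 + M * maxArity legs))
          ≤ ((done.map fun h => h.pend.length).sum + ∑ j ∈ rest, ((obs j).length + 1 + M * maxArity legs))
            + rpot obs M (maxArity legs) o.g o.rest o.done := by
  intro o ho extra hx
  have hV : ∑ _j ∈ o.rest, (1 + M * maxArity legs) ≤ ∑ _j ∈ rest.erase (rest.min' h), (1 + M * maxArity legs) :=
    Finset.sum_le_sum_of_subset (run_rest_subset _ _ _ o ho)
  have e_start : rpot obs M (maxArity legs) (pristine obs (rest.min' h)) (rest.erase (rest.min' h)) done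
      = (obs (rest.min' h)).length + 1 + M * maxArity legs + ∑ j ∈ rest.erase (rest.min' h), (obs j).length
        + (done.map fun h => h.pend.length).sum := by
    simp only [rpot, pristine, Nat.sub_zero]
  have e_end : rpot obs M (maxArity legs) o.g o.rest o.done = o.g.pend.length + 1 + (M - o.g.nv) * maxArity legs
      + ∑ j ∈ o.rest, (obs j).length + (o.done.map fun h => h.pend.length).sum := rfl
  rw [e_start, e_end, ← Finset.add_sum_erase rest (fun j => (obs j).length + 1 + M * maxArity legs) (rest.min'_mem h),
    sum_obs_split obs M (maxArity legs) (rest.erase _), sum_obs_split obs M (maxArity legs) o.rest]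
  omega

/-- **THE NUMBER OF TERMS OF THE LABELLED EXPANSION**: for `W ≥ Φ(done,rest) + Σ_m|legs m|`,
`#expand done rest ≤ W^{Φ(done,rest)}`, `Φ(done,rest) = Σ_{h∈done}|pend h| + Σ_{j∈rest}(|obs j| + 1 + M·maxArity)` — each
run has at most `W^{rpot released}` outcomes weighted by what it leaves (`run_wcount_le`), and the potential telescopes
(`expand_pot_key`). [cite: BalabanImbrieJaffe1988, §5.14 p.311–312] -/
theorem card_expand_le : ∀ (n : ℕ) (done : Multiset (LGrp S κ)) (rest : Finset κ), rest.card < n → ∀ W : ℕ,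
    (done.map fun h => h.pend.length).sum + ∑ j ∈ rest, ((obs j).length + 1 + M * maxArity legs)
        + ∑ m, (legs m).length ≤ W →
      Multiset.card (expand A f c legs obs M done rest)
        ≤ W ^ ((done.map fun h => h.pend.length).sum + ∑ j ∈ rest, ((obs j).length + 1 + M * maxArity legs))
  | 0, _, _, hn => fun _ _ => absurd hn (Nat.not_lt_zero _)
  | n + 1, done, rest, hn => by
    intro W hW
    by_cases h : rest.Nonempty
    · have hi := rest.min'_mem h
      have hRs := rpot_pristine_le_pot (legs := legs) (obs := obs) (M := M) h done
      have hR1 : 1 ≤ rpot obs M (maxArity legs) (pristine obs (rest.min' h)) (rest.erase (rest.min' h)) done := by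
        simp only [rpot]; omega
      have hW0 : 0 < W := by omega
      rw [expand_of_nonempty A f c legs obs M h, mbind, Multiset.card_bind]
      -- every outcome's continuation has at most W^{Φ − rpot(start) + rpot(o)} terms
      have hcont : ∀ o ∈ run A f c legs obs M (pristine obs (rest.min' h)) (rest.erase (rest.min' h)) done,
          Multiset.card (if o.g.IsConst M then (expand A f c legs obs M o.done o.rest).map fun t => (oact o t).addConst o.g
            else (expand A f c legs obs M (o.g ::ₘ o.done) o.rest).map (oact o))
          ≤ W ^ ((done.map fun h => h.pend.length).sum + ∑ j ∈ rest, ((obs j).length + 1 + M * maxArity legs)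
              - rpot obs M (maxArity legs) (pristine obs (rest.min' h)) (rest.erase (rest.min' h)) done)
            * W ^ rpot obs M (maxArity legs) o.g o.rest o.done := by
        intro o ho
        have hcard : o.rest.card < n := lt_of_lt_of_le (lt_of_le_of_lt (Finset.card_le_card (run_rest_subset _ _ _ o ho))
          (Finset.card_erase_lt_of_mem hi)) (Nat.lt_succ_iff.1 hn)
        have hle := (run_rpot_dirs_le _ _ _ o ho)
        rw [← pow_add]
        split_ifs with hg
        · have key := expand_pot_key h done o ho 0 (Nat.zero_le _)
          rw [Multiset.card_map]
          refine (card_expand_le n o.done o.rest hcard W (by omega)).trans (Nat.pow_le_pow_right hW0 ?_)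
          omega
        · have key := expand_pot_key h done o ho o.g.pend.length le_rfl
          rw [Multiset.card_map]
          refine (card_expand_le n (o.g ::ₘ o.done) o.rest hcard W ?_).trans (Nat.pow_le_pow_right hW0 ?_)
          · rw [Multiset.map_cons, Multiset.sum_cons]; omega
          · rw [Multiset.map_cons, Multiset.sum_cons]; omega
      calc _ ≤ ((run A f c legs obs M (pristine obs (rest.min' h)) (rest.erase (rest.min' h)) done).attach.map fun o =>
              W ^ ((done.map fun h => h.pend.length).sum + ∑ j ∈ rest, ((obs j).length + 1 + M * maxArity legs)
                - rpot obs M (maxArity legs) (pristine obs (rest.min' h)) (rest.erase (rest.min' h)) done)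
              * W ^ rpot obs M (maxArity legs) o.1.g o.1.rest o.1.done).sum :=
            Multiset.sum_map_le_sum_map _ _ fun o _ => hcont o.1 o.2
        _ = W ^ ((done.map fun h => h.pend.length).sum + ∑ j ∈ rest, ((obs j).length + 1 + M * maxArity legs)
                - rpot obs M (maxArity legs) (pristine obs (rest.min' h)) (rest.erase (rest.min' h)) done)
            * ((run A f c legs obs M (pristine obs (rest.min' h)) (rest.erase (rest.min' h)) done).map fun o =>
                W ^ rpot obs M (maxArity legs) o.g o.rest o.done).sum := by
            rw [Multiset.sum_map_mul_left, ← Multiset.attach_map_val'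
              (run A f c legs obs M (pristine obs (rest.min' h)) (rest.erase (rest.min' h)) done)]
        _ ≤ W ^ ((done.map fun h => h.pend.length).sum + ∑ j ∈ rest, ((obs j).length + 1 + M * maxArity legs)
                - rpot obs M (maxArity legs) (pristine obs (rest.min' h)) (rest.erase (rest.min' h)) done)
            * W ^ rpot obs M (maxArity legs) (pristine obs (rest.min' h)) (rest.erase (rest.min' h)) done :=
            Nat.mul_le_mul_left _ (run_wcount_le _ _ _ _ (Nat.lt_succ_self _) W (by omega))
        _ = _ := by rw [← pow_add, Nat.sub_add_cancel hRs]
    · obtain rfl := Finset.not_nonempty_iff_eq_empty.1 h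
      rw [expand_of_not_nonempty A f c legs obs M h, Multiset.card_singleton]
      rcases Nat.eq_zero_or_pos W with rfl | hW0
      · have h0 : (done.map fun h => h.pend.length).sum + ∑ j ∈ (∅ : Finset κ), ((obs j).length + 1 + M * maxArity legs)
            = 0 := by omega
        rw [h0, pow_zero]
      · exact Nat.one_le_pow _ _ hW0

/-- **THE NUMBER OF TERMS OF THE EXPANSION OF A PRODUCT OF OBSERVABLES** `K` (nothing set aside):
`#expand 0 K ≤ W^{Φ₀(K)}` for `W ≥ Φ₀(K) + Σ_m|legs m|`, `Φ₀(K) = Σ_{j∈K}(|obs j| + 1 + M·maxArity)`.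
[cite: BalabanImbrieJaffe1988, §5.14 p.311–312] -/
theorem card_expand_zero_le (K : Finset κ) {W : ℕ}
    (hW : ∑ j ∈ K, ((obs j).length + 1 + M * maxArity legs) + ∑ m, (legs m).length ≤ W) :
    Multiset.card (expand A f c legs obs M 0 K) ≤ W ^ ∑ j ∈ K, ((obs j).length + 1 + M * maxArity legs) := by
  have h := card_expand_le (A := A) (f := f) (c := c) (legs := legs) (obs := obs) (M := M) _ 0 K (Nat.lt_succ_self _) W
  rw [Multiset.map_zero, Multiset.sum_zero, zero_add] at h
  exact h hW

/-- **THE NUMBER OF TERMS OF THE EXPANSION OF A PRODUCT OF OBSERVABLES**, explicit: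
`#expand 0 K ≤ (Φ₀(K) + Σ_m|legs m|)^{Φ₀(K)}`. [cite: BalabanImbrieJaffe1988, §5.14 p.311–312] -/
theorem card_expand_init_le (K : Finset κ) :
    Multiset.card (expand A f c legs obs M 0 K)
      ≤ (∑ j ∈ K, ((obs j).length + 1 + M * maxArity legs) + ∑ m, (legs m).length)
          ^ ∑ j ∈ K, ((obs j).length + 1 + M * maxArity legs) :=
  card_expand_zero_le K le_rfl

/-- **THE SIZE OF A TERM IS PAID BY THE POTENTIAL**: the pending legs of the set-aside components of a term plus its
`χ′`-directions number at most `Φ(done,rest)`. [cite: BalabanImbrieJaffe1988, §5.14 p.311] -/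
theorem expand_size_le : ∀ (n : ℕ) (done : Multiset (LGrp S κ)) (rest : Finset κ), rest.card < n →
    ∀ t ∈ expand A f c legs obs M done rest,
      (t.groups.map fun h => h.pend.length).sum + t.dirs.length
        ≤ (done.map fun h => h.pend.length).sum + ∑ j ∈ rest, ((obs j).length + 1 + M * maxArity legs)
  | 0, _, _, hn => fun _ _ => absurd hn (Nat.not_lt_zero _)
  | n + 1, done, rest, hn => by
    intro t ht
    by_cases h : rest.Nonempty
    · rw [expand_of_nonempty A f c legs obs M h, mem_mbind] at ht
      obtain ⟨o, ho, ht⟩ := ht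
      have hcard : o.rest.card < n := lt_of_lt_of_le (lt_of_le_of_lt (Finset.card_le_card (run_rest_subset _ _ _ o ho))
        (Finset.card_erase_lt_of_mem (rest.min'_mem h))) (Nat.lt_succ_iff.1 hn)
      have hle := run_rpot_dirs_le _ _ _ o ho
      split_ifs at ht with hg
      · rw [Multiset.mem_map] at ht
        obtain ⟨t', ht', rfl⟩ := ht
        have ih := expand_size_le n o.done o.rest hcard t' ht'
        have key := expand_pot_key h done o ho 0 (Nat.zero_le _)
        rw [RTerm.addConst_groups, oact_groups, RTerm.addConst_dirs, oact_dirs, List.length_append]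
        omega
      · rw [Multiset.mem_map] at ht
        obtain ⟨t', ht', rfl⟩ := ht
        have ih := expand_size_le n (o.g ::ₘ o.done) o.rest hcard t' ht'
        have key := expand_pot_key h done o ho o.g.pend.length le_rfl
        rw [Multiset.map_cons, Multiset.sum_cons] at ih
        rw [oact_groups, oact_dirs, List.length_append]
        omega
    · rw [expand_of_not_nonempty A f c legs obs M h, Multiset.mem_singleton] at ht
      subst ht
      simp

/-- **Legs and directions of a term stay in `Dir`**: every pending leg of a set-aside component of a term lies in `Dir`
and every `χ′`-direction is `A⁻¹u` with `u ∈ Dir` (`Dir` ⊇ observables' legs, vertex legs, legs of `done`).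
[cite: BalabanImbrieJaffe1988, §5.14 p.311] -/
theorem expand_dir (hobs : ∀ j, ∀ w ∈ obs j, w ∈ Dir) (hlegs : ∀ m, ∀ w ∈ legs m, w ∈ Dir) :
    ∀ (n : ℕ) (done : Multiset (LGrp S κ)) (rest : Finset κ), rest.card < n →
      (∀ h ∈ done, ∀ w ∈ h.pend, w ∈ Dir) → ∀ t ∈ expand A f c legs obs M done rest,
        (∀ h ∈ t.groups, ∀ w ∈ h.pend, w ∈ Dir) ∧ ∀ z ∈ t.dirs, ∃ u ∈ Dir, A⁻¹ *ᵥ u = z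
  | 0, _, _, hn => fun _ _ _ => absurd hn (Nat.not_lt_zero _)
  | n + 1, done, rest, hn => by
    intro hd t ht
    by_cases h : rest.Nonempty
    · rw [expand_of_nonempty A f c legs obs M h, mem_mbind] at ht
      obtain ⟨o, ho, ht⟩ := ht
      have hcard : o.rest.card < n := lt_of_lt_of_le (lt_of_le_of_lt (Finset.card_le_card (run_rest_subset _ _ _ o ho))
        (Finset.card_erase_lt_of_mem (rest.min'_mem h))) (Nat.lt_succ_iff.1 hn)
      have hpr : ∀ w ∈ (pristine obs (rest.min' h)).pend, w ∈ Dir := hobs _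
      obtain ⟨hog, hod⟩ := run_dir hobs hlegs _ _ _ o ho hpr hd
      have hoD := run_dirs_mem hobs hlegs _ _ _ o ho hpr hd
      split_ifs at ht with hg
      · rw [Multiset.mem_map] at ht
        obtain ⟨t', ht', rfl⟩ := ht
        obtain ⟨ih1, ih2⟩ := expand_dir hobs hlegs n o.done o.rest hcard hod t' ht'
        refine ⟨fun h hh => ih1 h (by simpa using hh), fun z hz => ?_⟩
        rw [RTerm.addConst_dirs, oact_dirs, List.mem_append] at hz
        exact hz.elim (hoD z) (ih2 z)
      · rw [Multiset.mem_map] at ht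
        obtain ⟨t', ht', rfl⟩ := ht
        have hod' : ∀ h ∈ o.g ::ₘ o.done, ∀ w ∈ h.pend, w ∈ Dir := fun h hh => by
          rcases Multiset.mem_cons.1 hh with rfl | hh
          · exact hog
          · exact hod h hh
        obtain ⟨ih1, ih2⟩ := expand_dir hobs hlegs n (o.g ::ₘ o.done) o.rest hcard hod' t' ht'
        refine ⟨fun h hh => ih1 h (by simpa using hh), fun z hz => ?_⟩
        rw [oact_dirs, List.mem_append] at hz
        exact hz.elim (hoD z) (ih2 z)
    · rw [expand_of_not_nonempty A f c legs obs M h, Multiset.mem_singleton] at ht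
      subst ht
      exact ⟨hd, fun z hz => absurd hz List.not_mem_nil⟩

/-! ## §3  Every block and every remainder component carries an observable -/

/-- **Every constant component and every remainder component of a term contains at least one observable** (labels
only grow along a run, and a run starts from the pristine component of an observable; cf. p. 312 *"each one covers
at least one X_{σ_i}"*). [cite: BalabanImbrieJaffe1988, §5.14 p.311–312] -/
theorem expand_lab_nonempty : ∀ (n : ℕ) (done : Multiset (LGrp S κ)) (rest : Finset κ), rest.card < n →
    (∀ h ∈ done, h.lab.Nonempty) → ∀ t ∈ expand A f c legs obs M done rest, ∀ h ∈ t.consts + t.groups, h.lab.Nonempty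
  | 0, _, _, hn => fun _ _ _ => absurd hn (Nat.not_lt_zero _)
  | n + 1, done, rest, hn => by
    intro hd t ht
    by_cases h : rest.Nonempty
    · rw [expand_of_nonempty A f c legs obs M h, mem_mbind] at ht
      obtain ⟨o, ho, ht⟩ := ht
      have hcard : o.rest.card < n := lt_of_lt_of_le (lt_of_le_of_lt (Finset.card_le_card (run_rest_subset _ _ _ o ho))
        (Finset.card_erase_lt_of_mem (rest.min'_mem h))) (Nat.lt_succ_iff.1 hn)
      have hog : o.g.lab.Nonempty :=
        ⟨rest.min' h, (run_mono _ _ _ o ho).2.2 (by simp [pristine])⟩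
      have hod : ∀ h ∈ o.done, h.lab.Nonempty :=
        fun h hh => hd h (Multiset.mem_of_le (run_done_le _ _ _ o ho) hh)
      split_ifs at ht with hg
      · rw [Multiset.mem_map] at ht
        obtain ⟨t', ht', rfl⟩ := ht
        have ih := expand_lab_nonempty n o.done o.rest hcard hod t' ht'
        intro h hh
        rw [RTerm.addConst_consts, oact_consts, RTerm.addConst_groups, oact_groups, Multiset.cons_add,
          Multiset.mem_cons] at hh
        rcases hh with rfl | hh
        · exact hog
        · exact ih h hh
      · rw [Multiset.mem_map] at ht
        obtain ⟨t', ht', rfl⟩ := ht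
        have hod' : ∀ h ∈ o.g ::ₘ o.done, h.lab.Nonempty := fun h hh => by
          rcases Multiset.mem_cons.1 hh with rfl | hh
          · exact hog
          · exact hod h hh
        have ih := expand_lab_nonempty n (o.g ::ₘ o.done) o.rest hcard hod' t' ht'
        intro h hh
        rw [oact_consts, oact_groups] at hh
        exact ih h hh
    · rw [expand_of_not_nonempty A f c legs obs M h, Multiset.mem_singleton] at ht
      subst ht
      intro h hh
      rw [zero_add] at hh
      exact hd h hh

/-- **A term of the remainder observable `remv(O)`, `O ≠ ∅`, has a remainder component**: a term of `expand 0 O` with no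
block has a set-aside component (its components carry all of `O`, `expand_lab`). [cite: BalabanImbrieJaffe1988, §5.14 p.312] -/
theorem groups_ne_zero_of_consts_eq_zero {O : Finset κ} (hO : O.Nonempty) :
    ∀ t ∈ expand A f c legs obs M 0 O, t.consts = 0 → t.groups ≠ 0 := by
  intro t ht hc hg
  have e := expand_lab (A := A) (f := f) (c := c) (legs := legs) (obs := obs) (M := M) _ 0 O (Nat.lt_succ_self _) t ht
  simp only [hc, hg, add_zero, Multiset.map_zero, Multiset.sup_zero, Finset.bot_eq_empty, Finset.empty_union] at e
  exact hO.ne_empty e.symm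

end Expand

end Literature.MathematicalPhysics.QuantumFieldTheory.BalabanImbrieJaffe1984to88.BIJ88LabelledTermCount312

end
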